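import Summits.SmoothPoincare4.SmoothPoincare4.Theorems.EntropyRungSubcylindricalExistenceTheoremA
import Summits.SmoothPoincare4.SmoothPoincare4.Theorems.EntropyRungSubcylindricalExistenceEntropyTestFunctions
import Literature.Geometry.Riemannian.AubinYamabeSphereEuclidean
import Literature.Geometry.Riemannian.ChangGurskyYangProofs
import Mathlib.Analysis.Calculus.Gradient.Basic
import Mathlib.MeasureTheory.Measure.Haar.NormedSpace
import HarnessLib

/-!
# RoundBound `ν(S⁴) ≥ log 6 − 2` read in stereographic coordinates on `ℝ⁴`
(stub S1 `stub_roundClauseEuclidean` of line `green-blowup-conformal-entropy`, crux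
`EntropyRung.SubcylindricalExistence`, item stmt-SmoothPoincare4-10871)

For `l > 0` put `u_l(y) = 4l/(l²‖y‖² + 4)` on `ℝ⁴ = EuclideanSpace ℝ (Fin 4)`; `u_l² δ` is the round
unit-sphere metric pulled back by `y ↦ σ⁻¹(l y)`, `σ = extChartAt (𝓡 4) v₀` Mathlib's stereographic
chart of `S⁴ = Metric.sphere (0 : EuclideanSpace ℝ (Fin 5)) 1` (`roundMetric_mfderiv_extChartAt_symm`).
We prove Perelman's `𝒲`-clause in `w²`-form for this metric at the level `log 6 − 2`, for all scales
`τ > 0`, all dilations `l > 0` and all smooth compactly supported `v`: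
`∫ (4πτ)⁻² v² u_l⁴ dy = 1 ⇒ log 6 − 2 ≤ ∫ [τ(12 v² + 4 u_l⁻² ‖∇v‖²) − v² log v² − 4 v²] (4πτ)⁻² u_l⁴ dy`.

Proof: the lift `w := 𝟙_{source σ} · (v ∘ (l⁻¹ •) ∘ σ)` is smooth on `S⁴` (it vanishes near the pole
`−v₀` by compactness of the support); RoundBound on the round `S⁴` for all smooth `f`
(`roundSphereFour_wEntropy_ge`) gives the `w²`-clause for `w` (`wClause_sq_of_wClause_exp`); the
sphere integrals are transported to `ℝ⁴` by `integral_roundMetric_eq_integral_chart`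
(`dV = (4/(‖z‖²+4))⁴ dz`), `innerDual_mvfderiv_roundMetric_extChartAt_symm`
(`|∇w|² ∘ σ⁻¹ = (4/(‖z‖²+4))⁻² ‖∇(w ∘ σ⁻¹)‖²`), `scalarCurvature_roundMetric` (`R = 12`), and then
dilated `z = l • y` (`MeasureTheory.Measure.integral_comp_smul_of_nonneg`, `fderiv_comp_smul`).

References: [Perelman2002Entropy] §3.1; [CaoHamiltonIlmanen2004] Thm 3.4; [LeeParker1987] §3 (3.3)–(3.4).
-/

noncomputable section

-- the registered namespace `Summit.SmoothPoincare4.SmoothPoincare4.Theorems` repeats a component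
set_option linter.dupNamespace false

open scoped Manifold ContDiff Topology RealInnerProductSpace Pointwise
-- Mathlib's scoped instance `Fact (finrank ℝ (EuclideanSpace ℝ (Fin n)) = n)`, feeding the
-- `[Fact (finrank ℝ V = n + 1)]` hypotheses of the sphere API
open scoped EuclideanSpace
open Set Filter MeasureTheory Metric Module
open Literature.Geometry.Lorentzian Literature.Geometry.Riemannian

namespace Summit.SmoothPoincare4.SmoothPoincare4.Theorems

namespace RoundClauseEuclidean

/-! ## Euclidean preliminaries: dilations -/

/-- `∇(P(c ·))(x) = c • (∇P)(c x)` (chain rule `fderiv_comp_smul`, linearity of the Riesz map).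
[folklore] -/
theorem gradient_comp_smul {E : Type*} [NormedAddCommGroup E] [InnerProductSpace ℝ E]
    [CompleteSpace E] (P : E → ℝ) (c : ℝ) (x : E) :
    gradient (fun y ↦ P (c • y)) x = c • gradient P (c • x) := by
  -- adapted from Literature/Analysis/FluidPDE/SteadyNSSolution.lean (`gradient_comp_smul_right`)
  rw [gradient, fderiv_comp_smul c, gradient, map_smulₛₗ]
  simp

/-- Dilation of Lebesgue measure on `ℝ⁴`: `∫ Ψ(z) dz = l⁴ ∫ Ψ(l y) dy` for `l > 0`. [folklore] -/
theorem integral_eq_pow_four_mul_integral_comp_smul (Ψ : EuclideanSpace ℝ (Fin 4) → ℝ) {l : ℝ}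
    (hl : 0 < l) : ∫ z, Ψ z = l ^ 4 * ∫ y, Ψ (l • y) := by
  have h := Measure.integral_comp_smul_of_nonneg volume Ψ l (hR := hl.le)
  rw [finrank_euclideanSpace_fin, smul_eq_mul] at h
  rw [h, ← mul_assoc, mul_inv_cancel₀ (pow_ne_zero 4 hl.ne'), one_mul]

/-! ## The stereographic chart of `S⁴` and the lift of a compactly supported function -/

/-- The target of Mathlib's stereographic chart of the sphere is all of `ℝ⁴`. [folklore] -/
theorem extChartAt_target_sphere (v₀ : sphere (0 : EuclideanSpace ℝ (Fin 5)) 1) :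
    (extChartAt (𝓡 4) v₀).target = univ := by
  -- adapted from Literature/Geometry/Riemannian/AubinYamabeSphereEuclidean.lean
  rw [extChartAt_target, ModelWithCorners.range_eq_univ, inter_univ,
    modelWithCornersSelf_coe_symm, preimage_id_eq, id]
  exact stereographic'_target (-v₀)

/-- The lift `w = 𝟙_{source σ} · v(l⁻¹ σ ·)` read back in the chart: `w(σ⁻¹ z) = v(l⁻¹ z)`.
[folklore] -/
theorem lift_extChartAt_symm (v₀ : sphere (0 : EuclideanSpace ℝ (Fin 5)) 1) (l : ℝ)
    (v : EuclideanSpace ℝ (Fin 4) → ℝ) (z : EuclideanSpace ℝ (Fin 4)) :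
    (extChartAt (𝓡 4) v₀).source.indicator
        (fun x ↦ v (l⁻¹ • extChartAt (𝓡 4) v₀ x)) ((extChartAt (𝓡 4) v₀).symm z) =
      v (l⁻¹ • z) := by
  have hz : z ∈ (extChartAt (𝓡 4) v₀).target := by
    rw [extChartAt_target_sphere]
    exact mem_univ z
  rw [indicator_of_mem ((extChartAt (𝓡 4) v₀).map_target hz),
    (extChartAt (𝓡 4) v₀).right_inv hz]

/-- **The lift is smooth on `S⁴`.** For `v ∈ C_c^∞(ℝ⁴)` and `l > 0`, the function
`w = 𝟙_{source σ} · v(l⁻¹ σ ·)` is smooth: on the chart domain it is `v ∘ (l⁻¹ •) ∘ σ`, and it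
vanishes identically off the compact (hence closed) set `σ⁻¹(l • tsupport v)`, which misses the pole.
[folklore] -/
theorem contMDiff_lift (v₀ : sphere (0 : EuclideanSpace ℝ (Fin 5)) 1) {l : ℝ} (hl : 0 < l)
    {v : EuclideanSpace ℝ (Fin 4) → ℝ} (hv : ContDiff ℝ ∞ v) (hcs : HasCompactSupport v) :
    ContMDiff (𝓡 4) 𝓘(ℝ, ℝ) ∞
      ((extChartAt (𝓡 4) v₀).source.indicator fun x ↦ v (l⁻¹ • extChartAt (𝓡 4) v₀ x)) := by
  have hV : ContDiff ℝ ∞ (fun z : EuclideanSpace ℝ (Fin 4) ↦ v (l⁻¹ • z)) :=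
    hv.comp (contDiff_const_smul _)
  have hcont : Continuous fun z : EuclideanSpace ℝ (Fin 4) ↦ (extChartAt (𝓡 4) v₀).symm z :=
    (contMDiff_extChartAt_symm_sphere (EuclideanSpace ℝ (Fin 5)) v₀ 0).continuous
  -- the compact set `A = σ⁻¹ (l • tsupport v)` off which the lift vanishes
  obtain ⟨A, hA⟩ : ∃ A : Set (sphere (0 : EuclideanSpace ℝ (Fin 5)) 1),
      A = (fun z ↦ (extChartAt (𝓡 4) v₀).symm z) '' (l • tsupport v) := ⟨_, rfl⟩
  have hAc : IsClosed A := by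
    rw [hA]
    exact ((hcs.isCompact.smul l).image hcont).isClosed
  have hzero : ∀ x ∉ A,
      (extChartAt (𝓡 4) v₀).source.indicator (fun x ↦ v (l⁻¹ • extChartAt (𝓡 4) v₀ x)) x = 0 := by
    intro x hx
    by_cases hxs : x ∈ (extChartAt (𝓡 4) v₀).source
    · rw [indicator_of_mem hxs]
      by_contra hne
      exact hx (hA ▸ ⟨extChartAt (𝓡 4) v₀ x, ⟨l⁻¹ • extChartAt (𝓡 4) v₀ x,
        subset_tsupport _ (Function.mem_support.2 hne), smul_inv_smul₀ hl.ne' _⟩,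
        (extChartAt (𝓡 4) v₀).left_inv hxs⟩)
    · rw [indicator_of_notMem hxs]
  intro x
  by_cases hx : x ∈ A
  · -- on the chart domain the lift is `v ∘ (l⁻¹ •) ∘ σ`
    rw [hA] at hx
    obtain ⟨z, -, rfl⟩ := hx
    have hz : z ∈ (extChartAt (𝓡 4) v₀).target := by
      rw [extChartAt_target_sphere]
      exact mem_univ z
    have hxs : (extChartAt (𝓡 4) v₀).symm z ∈ (extChartAt (𝓡 4) v₀).source :=
      (extChartAt (𝓡 4) v₀).map_target hz
    have hxs' : (extChartAt (𝓡 4) v₀).symm z ∈ (chartAt (EuclideanSpace ℝ (Fin 4)) v₀).source := by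
      rwa [← extChartAt_source (𝓡 4)]
    have h1 : ContMDiffAt (𝓡 4) 𝓘(ℝ, ℝ) ∞ (fun x ↦ v (l⁻¹ • extChartAt (𝓡 4) v₀ x))
        ((extChartAt (𝓡 4) v₀).symm z) :=
      hV.comp_contMDiffAt (contMDiffAt_extChartAt' hxs')
    refine h1.congr_of_eventuallyEq ?_
    filter_upwards [(isOpen_extChartAt_source v₀).mem_nhds hxs] with x' hx'
    rw [indicator_of_mem hx']
  · -- off `A` the lift vanishes near `x`
    refine (contMDiffAt_const (c := (0 : ℝ))).congr_of_eventuallyEq ?_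
    filter_upwards [hAc.isOpen_compl.mem_nhds hx] with x' hx'
    exact hzero x' hx'

/-- **`|∇w|²_{g_S}` of the lift in the chart**: `|∇w|²(σ⁻¹ z) = (4/(‖z‖²+4))⁻² l⁻² ‖∇v(l⁻¹ z)‖²`
(`innerDual_mvfderiv_roundMetric_extChartAt_symm` and the chain rule for the dilation). [folklore] -/
theorem gradSq_lift_extChartAt_symm (v₀ : sphere (0 : EuclideanSpace ℝ (Fin 5)) 1) {l : ℝ}
    (hl : 0 < l) {v : EuclideanSpace ℝ (Fin 4) → ℝ} (hv : ContDiff ℝ ∞ v)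
    (hcs : HasCompactSupport v) (z : EuclideanSpace ℝ (Fin 4)) :
    (roundMetric (n := 4) (EuclideanSpace ℝ (Fin 5))).gradSq
        ((extChartAt (𝓡 4) v₀).source.indicator fun x ↦ v (l⁻¹ • extChartAt (𝓡 4) v₀ x))
        ((extChartAt (𝓡 4) v₀).symm z) =
      ((4 / (‖z‖ ^ 2 + 4)) ^ 2)⁻¹ * (l⁻¹ ^ 2 * ‖gradient v (l⁻¹ • z)‖ ^ 2) := by
  have hws := contMDiff_lift v₀ hl hv hcs
  have h := innerDual_mvfderiv_roundMetric_extChartAt_symm (V := EuclideanSpace ℝ (Fin 5))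
    (n := 4) v₀ z (hws.mdifferentiableAt (by simp))
  have hfun : ((extChartAt (𝓡 4) v₀).source.indicator
      (fun x ↦ v (l⁻¹ • extChartAt (𝓡 4) v₀ x))) ∘ (extChartAt (𝓡 4) v₀).symm =
      fun z ↦ v (l⁻¹ • z) := by
    funext z
    exact lift_extChartAt_symm v₀ l v z
  refine h.trans ?_
  rw [hfun, gradient_comp_smul, norm_smul, Real.norm_of_nonneg (inv_nonneg.2 hl.le), mul_pow]

/-! ## Integrals over the round `S⁴` as dilated Euclidean integrals -/

/-- **Transport and dilation**: for continuous `F` on `S⁴` and `l > 0`,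
`∫_{S⁴} F dV = ∫_{ℝ⁴} u_l(y)⁴ F(σ⁻¹(l y)) dy`, `u_l(y) = 4l/(l²‖y‖²+4)`
(`integral_roundMetric_eq_integral_chart` and `z = l • y`). [cite: LeeParker1987, §3, (3.3)] -/
theorem integral_roundMetric_eq_integral_dilate (v₀ : sphere (0 : EuclideanSpace ℝ (Fin 5)) 1)
    {l : ℝ} (hl : 0 < l) {F : sphere (0 : EuclideanSpace ℝ (Fin 5)) 1 → ℝ} (hF : Continuous F) :
    ∫ x, F x ∂(riemannianMeasure ((roundMetric (n := 4) (EuclideanSpace ℝ (Fin 5)))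
        |>.toContMDiffRiemannianMetric isRiemannian_roundMetric)) =
      ∫ y : EuclideanSpace ℝ (Fin 4), (l * (4 / (l ^ 2 * ‖y‖ ^ 2 + 4))) ^ 4 *
        F ((extChartAt (𝓡 4) v₀).symm (l • y)) := by
  obtain ⟨-, hI⟩ :=
    integral_roundMetric_eq_integral_chart (EuclideanSpace ℝ (Fin 5)) v₀ (n := 4) hF
  rw [hI, integral_eq_pow_four_mul_integral_comp_smul _ hl, ← integral_const_mul]
  refine integral_congr_ae (Eventually.of_forall fun y ↦ ?_)
  simp only
  rw [norm_smul, Real.norm_of_nonneg hl.le, mul_pow, mul_pow, ← mul_assoc]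

/-! ## The clause -/

/-- **RoundBound in stereographic coordinates, with the lift made explicit.** For a chart centre
`v₀`, `l > 0`, `τ > 0`, `v ∈ C_c^∞(ℝ⁴)` normalised by `∫ (4πτ)⁻² v² u_l⁴ dy = 1`, and `w` the lift of
`v`: the `w²`-clause of the round `S⁴` at level `log 6 − 2` (`roundSphereFour_wEntropy_ge`,
`wClause_sq_of_wClause_exp`), transported to `ℝ⁴` and dilated, is the Euclidean clause for `v`.
[cite: CaoHamiltonIlmanen2004, Thm 3.4] -/
theorem clause_of_lift (v₀ : sphere (0 : EuclideanSpace ℝ (Fin 5)) 1) {l : ℝ} (hl : 0 < l)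
    {τ : ℝ} (hτ : 0 < τ) {v : EuclideanSpace ℝ (Fin 4) → ℝ} (hv : ContDiff ℝ ∞ v)
    (hcs : HasCompactSupport v) {w : sphere (0 : EuclideanSpace ℝ (Fin 5)) 1 → ℝ}
    (hw : w = (extChartAt (𝓡 4) v₀).source.indicator fun x ↦ v (l⁻¹ • extChartAt (𝓡 4) v₀ x))
    (hnorm : ∫ y, (4 * Real.pi * τ) ^ (-(4 : ℝ) / 2) * (v y) ^ 2 *
      (l * (4 / (l ^ 2 * ‖y‖ ^ 2 + 4))) ^ 4 = 1) :
    Real.log 6 - 2 ≤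
      ∫ y, (τ * (12 * (v y) ^ 2 + 4 * ((l * (4 / (l ^ 2 * ‖y‖ ^ 2 + 4)))⁻¹ ^ 2 * ‖gradient v y‖ ^ 2))
          - (v y) ^ 2 * Real.log ((v y) ^ 2) - 4 * (v y) ^ 2)
          * ((4 * Real.pi * τ) ^ (-(4 : ℝ) / 2) * (l * (4 / (l ^ 2 * ‖y‖ ^ 2 + 4))) ^ 4) := by
  haveI hLC : (roundMetric (n := 4) (EuclideanSpace ℝ (Fin 5))).HasLeviCivita :=
    (roundMetric (n := 4) (EuclideanSpace ℝ (Fin 5))).hasLeviCivita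
  have hws : ContMDiff (𝓡 4) 𝓘(ℝ, ℝ) ∞ w := by
    rw [hw]
    exact contMDiff_lift v₀ hl hv hcs
  have hwc : Continuous w := hws.continuous
  -- the lift and its gradient read at `σ⁻¹ (l • y)`, and `R = 12`
  have hwy : ∀ y : EuclideanSpace ℝ (Fin 4), w ((extChartAt (𝓡 4) v₀).symm (l • y)) = v y := by
    intro y
    rw [hw, lift_extChartAt_symm, inv_smul_smul₀ hl.ne']
  have hgy : ∀ y : EuclideanSpace ℝ (Fin 4),
      (roundMetric (n := 4) (EuclideanSpace ℝ (Fin 5))).gradSq w ((extChartAt (𝓡 4) v₀).symm (l • y))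
        = ((4 / (l ^ 2 * ‖y‖ ^ 2 + 4)) ^ 2)⁻¹ * (l⁻¹ ^ 2 * ‖gradient v y‖ ^ 2) := by
    intro y
    rw [hw, gradSq_lift_extChartAt_symm v₀ hl hv hcs, inv_smul_smul₀ hl.ne', norm_smul,
      Real.norm_of_nonneg hl.le, mul_pow]
  have hR : ∀ x, (roundMetric (n := 4) (EuclideanSpace ℝ (Fin 5))).scalarCurvature x = 12 := by
    intro x
    rw [scalarCurvature_roundMetric (EuclideanSpace ℝ (Fin 5)) x]
    norm_num
  -- the normalisation on the sphere
  have hnormS : ∫ x, (4 * Real.pi * τ) ^ (-(4 : ℝ) / 2) * w x ^ 2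
      ∂(riemannianMeasure ((roundMetric (n := 4) (EuclideanSpace ℝ (Fin 5)))
        |>.toContMDiffRiemannianMetric isRiemannian_roundMetric)) = 1 := by
    rw [integral_roundMetric_eq_integral_dilate v₀ hl
      (F := fun x ↦ (4 * Real.pi * τ) ^ (-(4 : ℝ) / 2) * w x ^ 2) (continuous_const.mul (hwc.pow 2))]
    refine (integral_congr_ae (Eventually.of_forall fun y ↦ ?_)).trans hnorm
    simp only [hwy]
    ring
  -- the `w²`-clause of the round `S⁴` for the lift
  have key := wClause_sq_of_wClause_exp (sphere (0 : EuclideanSpace ℝ (Fin 5)) 1)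
    (roundMetric (n := 4) (EuclideanSpace ℝ (Fin 5))) isRiemannian_roundMetric (Real.log 6 - 2) τ hτ
    (fun _ hf hn ↦ roundSphereFour_wEntropy_ge hτ hf hn) w hws hnormS
  -- transport of the right-hand side
  have hGc : Continuous ((roundMetric (n := 4) (EuclideanSpace ℝ (Fin 5))).gradSq w) :=
    (contMDiff_gradSq (roundMetric (n := 4) (EuclideanSpace ℝ (Fin 5))) hws).continuous
  have h12 : Continuous (roundMetric (n := 4) (EuclideanSpace ℝ (Fin 5))).scalarCurvature := by
    rw [show (roundMetric (n := 4) (EuclideanSpace ℝ (Fin 5))).scalarCurvature = fun _ ↦ 12 from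
      funext hR]
    exact continuous_const
  have hlog : Continuous fun x ↦ w x ^ 2 * Real.log (w x ^ 2) :=
    Real.continuous_mul_log.comp (hwc.pow 2)
  have hFc : Continuous fun x ↦
      (τ * ((roundMetric (n := 4) (EuclideanSpace ℝ (Fin 5))).scalarCurvature x * w x ^ 2
        + 4 * (roundMetric (n := 4) (EuclideanSpace ℝ (Fin 5))).gradSq w x)
      - w x ^ 2 * Real.log (w x ^ 2) - 4 * w x ^ 2) * (4 * Real.pi * τ) ^ (-(4 : ℝ) / 2) :=
    (((continuous_const.mul ((h12.mul (hwc.pow 2)).add (continuous_const.mul hGc))).sub hlog).sub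
      (continuous_const.mul (hwc.pow 2))).mul continuous_const
  rw [integral_roundMetric_eq_integral_dilate v₀ hl hFc] at key
  refine key.trans_eq (integral_congr_ae (Eventually.of_forall fun y ↦ ?_))
  simp only [hwy, hgy, hR]
  have hP : (l ^ 2 * ‖y‖ ^ 2 + 4) ≠ 0 := by positivity
  field_simp

end RoundClauseEuclidean

open RoundClauseEuclidean in
/-- **RoundBound in stereographic coordinates (workhorse form).** For `l > 0`, `τ > 0` and
`v ∈ C_c^∞(ℝ⁴)` with `∫ (4πτ)⁻² v² u_l⁴ dy = 1`, `u_l(y) = 4l/(l²‖y‖²+4)`: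
`log 6 − 2 ≤ ∫ [τ(12 v² + 4 u_l⁻² ‖∇v‖²) − v² log v² − 4 v²] (4πτ)⁻² u_l⁴ dy` — Perelman's `𝒲` in
`w²`-form of the round metric `u_l² δ` (`R = 12`) is bounded below by `ν(S⁴) = log 6 − 2`.
[cite: CaoHamiltonIlmanen2004, Thm 3.4] -/
theorem roundClauseEuclidean {l : ℝ} (hl : 0 < l) {τ : ℝ} (hτ : 0 < τ)
    {v : EuclideanSpace ℝ (Fin 4) → ℝ} (hv : ContDiff ℝ ∞ v) (hcs : HasCompactSupport v)
    (hnorm : ∫ y, (4 * Real.pi * τ) ^ (-(4 : ℝ) / 2) * (v y) ^ 2 *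
      (l * (4 / (l ^ 2 * ‖y‖ ^ 2 + 4))) ^ 4 = 1) :
    Real.log 6 - 2 ≤
      ∫ y, (τ * (12 * (v y) ^ 2 + 4 * ((l * (4 / (l ^ 2 * ‖y‖ ^ 2 + 4)))⁻¹ ^ 2 * ‖gradient v y‖ ^ 2))
          - (v y) ^ 2 * Real.log ((v y) ^ 2) - 4 * (v y) ^ 2)
          * ((4 * Real.pi * τ) ^ (-(4 : ℝ) / 2) * (l * (4 / (l ^ 2 * ‖y‖ ^ 2 + 4))) ^ 4) := by
  obtain ⟨v₀⟩ : Nonempty (sphere (0 : EuclideanSpace ℝ (Fin 5)) 1) :=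
    (NormedSpace.sphere_nonempty.2 zero_le_one).to_subtype
  exact clause_of_lift v₀ hl hτ hv hcs rfl hnorm

/-- **Stub S1 of line `green-blowup-conformal-entropy` — RoundBound `ν(S⁴) ≥ log 6 − 2` in
stereographic coordinates on `ℝ⁴`, all dilations `l > 0`, all scales `τ > 0` (registered form).**
With `u_l(y) = 4l/(l²‖y‖²+4)` (`u_l² δ` = the round unit `S⁴` pulled back by `y ↦ σ⁻¹(l y)`), for every
smooth compactly supported `v` with `∫ (4πτ)⁻² v² u_l⁴ dy = 1`,
`log 6 − 2 ≤ ∫ [τ(12 v² + 4 u_l⁻² ‖∇v‖²) − v² log v² − 4 v²] (4πτ)⁻² u_l⁴ dy`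
(`roundSphereFour_wEntropy_ge` + `wClause_sq_of_wClause_exp`, transported along Mathlib's
stereographic chart and dilated). [cite: CaoHamiltonIlmanen2004, Thm 3.4] -/
theorem stub_roundClauseEuclidean :
    ∀ (l : ℝ), 0 < l → ∀ τ : ℝ, 0 < τ → ∀ v : EuclideanSpace ℝ (Fin 4) → ℝ, ContDiff ℝ ∞ v →
      HasCompactSupport v →
      ∫ y, (4 * Real.pi * τ) ^ (-(4 : ℝ) / 2) * (v y) ^ 2 * (l * (4 / (l ^ 2 * ‖y‖ ^ 2 + 4))) ^ 4 = 1 →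
        Real.log 6 - 2 ≤
          ∫ y, (τ * (12 * (v y) ^ 2 + 4 * ((l * (4 / (l ^ 2 * ‖y‖ ^ 2 + 4)))⁻¹ ^ 2 * ‖gradient v y‖ ^ 2))
              - (v y) ^ 2 * Real.log ((v y) ^ 2) - 4 * (v y) ^ 2)
              * ((4 * Real.pi * τ) ^ (-(4 : ℝ) / 2) * (l * (4 / (l ^ 2 * ‖y‖ ^ 2 + 4))) ^ 4) := by
  intro l hl τ hτ v hv hcs hnorm
  exact roundClauseEuclidean hl hτ hv hcs hnorm

end Summit.SmoothPoincare4.SmoothPoincare4.Theorems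

end
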